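import Literature.Computability.QuantumComplexity.CoreDescBlockFP
import Literature.Computability.QuantumComplexity.GRStagePlaced
import Literature.Computability.QuantumComplexity.QFTStagePlaced
import Literature.Computability.Complexity.CodeFPLists
import HarnessLib

/-!
# Abstract gate lists of transported stages, and wire maps on codes

Topic `Literature/Computability/QuantumComplexity`; generic lemmas for the uniformity pipeline of structured
Clifford+T families (`CoreDescAbstract.lean` … `CoreDescUniform.lean`, `AbstractGateUniform.lean`; Arora–Barak 2009,
§6.2 and proof of Thm. 6.15). A STAGE of a register machine is one block circuit transported to every register
(`GRStage.stageCircuit`: Grover–Rudolph blocks; `QFTStage.stageCircuit`: Fourier blocks — Regev 2009, Lemma 3.14,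
proof); its abstract gate list (`AJLCore.toAG`) is the block's abstract list with the wires renamed register by
register (`AJLCore.AGmap`):

* `map_toAG_mapWires` — `(mapWires ι C).gates.map toAG = (C.gates.map toAG).map (AGmap f)` for any `f : ℕ → ℕ`
  agreeing with `ι` on values (from `toAG_mapWiresGate`);
* **`GRStage.map_toAG_stageCircuit`**, **`QFTStage.map_toAG_stageCircuit`** — the two stage constructors abstract to
  `(List.finRange n).flatMap fun i => blockA.map (AGmap (f i))`;
* **`AGmap_codeFP`**, `mapAGmap_codeFP` — renaming the wires of an abstract gate / gate list by a map computed on codes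
  (`CodeFP (pairE eσ natE) natE (fun q => f q.1 q.2)` ⇒ `CodeFP (pairE eσ agE0) agE0 (fun t => AGmap (f t.1) t.2)`),
  generalising `AJLCore.AGmap_fp` (there for the specific AJL block embedding).

No named fact is introduced.

HONEST FRAMING: the VALUE is a THEOREM (kernel-checked generic lemmas of KNOWN complexity theory) — NOT summit
progress; no trust base changes.

## References

* S. Arora, B. Barak, *Computational Complexity: A Modern Approach*, CUP 2009, §6.1–§6.2 and proof of Thm. 6.15
  [AroraBarak2009].
* O. Regev, *On lattices, learning with errors, random linear codes, and cryptography*, J. ACM 56(6) (2009),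
  Lemma 3.14 (proof: the same block on every register) [Regev2009].
* M. A. Nielsen, I. L. Chuang, *Quantum Computation and Quantum Information*, CUP 2010, §4.5 [NielsenChuang2010].
-/

noncomputable section

namespace Literature.Computability.QuantumComplexity

open _root_.Computability Cryptography Complexity Complexity.CodeFP AJLCore

/-! ### Transported circuits -/

/-- **Abstraction of a transported circuit**: the wires are renamed by any `ℕ`-function agreeing with the embedding on
values. [cite: AroraBarak2009, §6.1] -/
theorem map_toAG_mapWires {b W : ℕ} (ι : Fin b ↪ Fin W) (f : ℕ → ℕ) (hf : ∀ x : Fin b, f x = (ι x : ℕ))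
    (C : QCircuit cliffordT b) : (mapWires ι C).gates.map toAG = (C.gates.map toAG).map (AGmap f) := by
  rw [gates_mapWires, List.map_map, List.map_map]
  exact List.map_congr_left fun g _ => toAG_mapWiresGate ι f hf g

/-- The gates of a chain of circuits listed in reverse are the concatenation in list order. [folklore] -/
theorem gates_chainCircuit_reverse {N : ℕ} (L : List (QCircuit cliffordT N)) :
    (chainCircuit L.reverse).gates = L.flatMap QCircuit.gates := by
  rw [gates_chainCircuit, List.reverse_reverse]

/-! ### The Grover–Rudolph stage -/

namespace GRStage

variable {B ℓ np : ℕ} {kit : GadgetKit B} {ws : Fin ℓ ↪ Fin B} {pw : Fin np ↪ Fin B} {a : Fin ℓ → (Fin ℓ → Bool) → ℝ}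
  (D : GRBlock.Data kit ws pw a) {n W : ℕ} (E : Fin n → (Fin B ↪ Fin W))

/-- **The Grover–Rudolph stage abstracts to the block's abstract list renamed register by register.**
[cite: Regev2009, Lemma 3.14 (proof)] [cite: AroraBarak2009, §6.2] -/
theorem map_toAG_stageCircuit (f : Fin n → ℕ → ℕ) (hf : ∀ i (x : Fin B), f i x = (E i x : ℕ)) :
    (stageCircuit D E).gates.map toAG =
      (List.finRange n).flatMap fun i => ((blockCircuit D).gates.map toAG).map (AGmap (f i)) := by
  rw [stageCircuit, List.map_flatMap]
  exact List.flatMap_congr fun i _ => map_toAG_mapWires (E i) (f i) (hf i) _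

end GRStage

/-! ### The Fourier stage -/

namespace QFTStage

variable {n k W κ : ℕ} (E : Fin n → (Fin (QFTKit.qbsize κ k) ↪ Fin W)) (hk1 : 1 ≤ k)

/-- **The Fourier stage abstracts to the block's abstract list renamed register by register.**
[cite: Regev2009, Lemma 3.14 (proof)] [cite: AroraBarak2009, §6.2] -/
theorem map_toAG_stageCircuit (f : Fin n → ℕ → ℕ) (hf : ∀ i (x : Fin (QFTKit.qbsize κ k)), f i x = (E i x : ℕ)) :
    (stageCircuit E hk1).gates.map toAG =
      (List.finRange n).flatMap fun i => ((block (κ := κ) hk1).gates.map toAG).map (AGmap (f i)) := by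
  rw [stageCircuit, gates_chainCircuit_reverse, List.map_flatMap, List.ofFn_eq_map, List.flatMap_map]
  exact List.flatMap_congr fun i _ => map_toAG_mapWires (E i) (f i) (hf i) _

end QFTStage

/-! ### Wire maps on codes -/

section Codes

variable {σ : Type} {eσ : σ → List Bool}

/-- **Renaming the wires of an abstract gate by a map computed on codes.** [cite: AroraBarak2009, §6.2] -/
theorem AGmap_codeFP {f : σ → ℕ → ℕ} (hf : CodeFP (pairE eσ natE) natE (fun q => f q.1 q.2)) :
    CodeFP (pairE eσ agE0) agE0 (fun t => AGmap (f t.1) t.2) := by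
  have hT : CodeFP (pairE eσ agE0) ctE (fun t => agTuple t.2) :=
    (transparent (eα := agE0) (eβ := ctE) (g := agTuple) fun _ => rfl).comp (snd _ _)
  have hws : CodeFP (pairE eσ agE0) (rawE natE) (fun t => (agTuple t.2).2.map (f t.1)) :=
    ((map (σ := σ) (α := ℕ) (g := fun q => f q.1 q.2) hf).comp ((fst _ _).pair hT.snd')).congr fun _ => rfl
  exact ag_of_tuple (hT.fst'.pair hws) fun _ => rfl

/-- **Renaming the wires of an abstract gate list by a map computed on codes.** [cite: AroraBarak2009, §6.2] -/
theorem mapAGmap_codeFP {f : σ → ℕ → ℕ} (hf : CodeFP (pairE eσ natE) natE (fun q => f q.1 q.2)) :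
    CodeFP (pairE eσ (rawE agE0)) (rawE agE0) (fun t => t.2.map (AGmap (f t.1))) :=
  (map (σ := σ) (α := AG) (g := fun q => AGmap (f q.1) q.2) (AGmap_codeFP hf)).congr fun _ => rfl

/-- **A stage on codes**: if the block's abstract list and the register wire maps `(c, i, w) ↦ f c i w` are computed on
codes, so is `c ↦ (List.range (min (n c) cap)).flatMap fun i => blockA c |>.map (AGmap (f c i))` (ranges capped by the
unary first component). [cite: AroraBarak2009, §6.2 and proof of Thm. 6.15] -/
theorem stageA_codeFP {blockA : σ → List AG} {n : σ → ℕ} {f : σ → ℕ → ℕ → ℕ}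
    (hb : CodeFP eσ (rawE agE0) blockA) (hn : CodeFP eσ natE n)
    (hf : CodeFP (pairE (pairE eσ natE) natE) natE (fun q => f q.1.1 q.1.2 q.2)) :
    CodeFP (pairE unE eσ) (rawE agE0)
      (fun p => (List.range (min (n p.2) p.1)).flatMap fun i => (blockA p.2).map (AGmap (f p.2 i))) := by
  have hitem : CodeFP (pairE (pairE unE eσ) natE) (rawE agE0) (fun c => (blockA c.1.2).map (AGmap (f c.1.2 c.2))) := by
    have hf' : CodeFP (pairE (pairE (pairE unE eσ) natE) natE) natE (fun q => f q.1.1.2 q.1.2 q.2) :=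
      (hf.comp (((fst _ _).fst'.snd'.pair (fst _ _).snd').pair (snd _ _)) :)
    exact ((mapAGmap_codeFP (σ := (ℕ × σ) × ℕ) (f := fun c w => f c.1.2 c.2 w) hf').comp
      ((CodeFP.id _).pair (hb.comp (fst _ _).snd')) :)
  have h : CodeFP (pairE unE eσ) (rawE (rawE agE0))
      (fun p => (List.range (min (n p.2) p.1)).map fun i => (blockA p.2).map (AGmap (f p.2 i))) :=
    ((map hitem).comp ((CodeFP.id _).pair (rangeOf.comp ((fst _ _).pair (hn.comp (snd _ _))))) :)
  exact ((flatten agE0).comp h).congr fun _ => rfl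

end Codes

end Literature.Computability.QuantumComplexity

end
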